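import Summits.QuantumFields.YangMills.Theorems.BalabanUVNodesN15NeumannCubeLiftDefect
import Summits.QuantumFields.YangMills.Theorems.BalabanUVNodesN15NeumannCubeOutputRowDefect
import HarnessLib

/-!
# Route «BalabanUVNodes» (K3⁷), node N15 = NE2, -a lane, PROGRAMME P file P-IId: ROWS OF THE LIFTED NEUMANN CUBES AT ANY SPACING (the fine members `L^r·L^k`) AND THE (α) ADJOINT-DIFFERENCE
# OUTPUT ROWS with their two-grid η-defect, on the torus family of record — cube side `L^s` FIXED, volume FREE, programme N's constants

Cell `pub-ymgap`, seat `pub-ymgap-dag-n15-a` (KNIT-BY-NAME, g20; D-0062; chair R424 venue; `bears_on: R4∕N15`); `--kind proof --supports stmt-QuantumFields-20544 --as helper`.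
Sequel of P-IIa∕b∕c (`…NeumannCubeLift`, `…LiftRows`, `…LiftDefect`) over programme N's rows N-IIc `hasMaj_chiCube_neumannCubeG_fine` (fine member's letter), N-IIf `hasMaj_chiCube_divAdjOut_neumannCubeG_pair`
((α) output-cut adjoint rows), N-IIh `hasMaj_idef_chiCube_divAdjOut_neumannCubeG` (their two-grid defect).  CONSUMER: dag-n15-c's `hasMaj_idef_glued_of_cutRows` rows `hG′c`, `hDbc`, and the (α) defect pieces.

WHAT.  §14 `mulOp_chiCube_comp_divAdj_comp_liftCubeG` (the cut adjoint-difference row of the lift IS a transplant: `∇*` descends, P-IIb `symbOp_divAdj_comp_pullVR`), ★★ `hasMaj_transplant_cube_family_spacing`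
(the family transfer theorem at ANY spacing `n`, blocks `⌊x∕n⌋`), ★★ `hasMaj_chiCube_liftCubeG_fine` (`hG′c`), ★★ `hasMaj_chiCube_divAdjOut_liftCubeG_pair` (both spacings), ★★★ `hasMaj_idef_chiCube_divAdjOut_liftCubeG`
(N-IIh's letter `1_□1_□·m·(L^k)^{−1∕16}·e^{−δd}`) — for EVERY `s ≤ m_T`, `k`, `r`, corner `c`: UNIFORM in the volume.
HONEST FRAMING.  Count-neutral; block-majorant bookkeeping over LANDED rows (no new analytic estimate); `U ≡ 1` torus MODEL of [B5] §1; the entry-2 SANDWICHED rows (N-IIg, input-side `∇*`) are not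
here (they need the restriction∕shift commutation for multipliers one step inside the cube — on the consumer's word); nothing of [B6] (2.38)–(2.40)∕[B9] asserted; NE2⁺ NOT PRINTED; N15 NOT
discharged (object-bound); counts UNMOVED (typed 28∕28 · discharged 5∕27); finite tori at fixed lattice spacing — NOT continuum ∕ ℝ⁴ ∕ OS ∕ mass gap ∕ Clay.  No new definition; every theorem is
[folklore] lattice algebra ∕ bookkeeping about printed objects.
-/

noncomputable section

open scoped BigOperators Matrix
open Finset

namespace Summit.QuantumFields.YangMills.BalabanUVNodes.N15.TwoGrid

open Literature.MathematicalPhysics.QuantumFieldTheory.Balaban1983to89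
open Literature.MathematicalPhysics.QuantumFieldTheory.Balaban1983to89.B5Prop11Plancherel (Tor fine unitVec)
open Literature.MathematicalPhysics.QuantumFieldTheory.Balaban1983to89.B5Block118 (tstep up upHom iota bpt)
open Literature.MathematicalPhysics.QuantumFieldTheory.Balaban1983to89.B5SiteBridgeP12 (MP)

variable {d : ℕ}

/-! ## §14 Rows at ANY spacing `n` on the torus family of record (the fine members `n = L^r·L^k`); the adjoint-difference output rows and their two-grid defect -/

section AnySpacing

open Literature.MathematicalPhysics.QuantumFieldTheory.Balaban1983to89.B6Prop26Gluing (mulOp mulOp_apply ind ind_nonneg ind_le_one)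
open Literature.MathematicalPhysics.QuantumFieldTheory.Balaban1983to89.B6Prop26ReachTransplant (restrictOp extendOp transplant)
open Literature.MathematicalPhysics.QuantumFieldTheory.King1986.Torus (blockOf tdistT)
open Literature.MathematicalPhysics.QuantumFieldTheory.Balaban1983to89.T4EtaRateDefect (idef)
open Literature.MathematicalPhysics.QuantumFieldTheory.Balaban1983to89.T4EtaRateCoeffDefect (pull pull_apply)
open Literature.MathematicalPhysics.QuantumFieldTheory.Balaban1983to89.B11SectG (BlockNorm HasMaj)
open Literature.MathematicalPhysics.QuantumFieldTheory.Balaban1983to89.B6UnitTorusCarrier (unitTorusGeo)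
open Literature.MathematicalPhysics.QuantumFieldTheory.Balaban1983to89.B5SiteBridgeP12 (MP)
open Summit.QuantumFields.YangMills.BalabanUVNodes.N15.VectorPiece (kingPr kingPrV kingPrV_eq blkFine)

variable {L : ℕ} [NeZero L]

/-- the cut lifted ADJOINT-difference row operator IS a transplant: `M_{χ_□} ∘ ∇*_ν ∘ G^{↑}(□) = transplant W π (∇*′_ν ∘ G(□′))` (the adjoint difference descends). [folklore] -/
theorem mulOp_chiCube_comp_divAdj_comp_liftCubeG {M M' : Fin (d + 1) → ℕ} [∀ μ, NeZero (M μ)] [∀ μ, NeZero (M' μ)] (n : ℕ) [NeZero n] (hM : ∀ μ, M' μ ∣ M μ) (c : Tor M) (S : ℕ)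
    (a : ℝ) (ν : Fin (d + 1)) (cc : ℝ) :
    mulOp (chiCube M n c S) ∘ₗ symbOp M n (cc • (sTinv M n ν - 1)) ∘ₗ liftCubeG n hM c S a =
      transplant (cubeW n c S) (redBond n hM) (symbOp M' n (cc • (sTinv M' n ν - 1)) ∘ₗ neumannCubeG M' n (torRed hM c) S a) := by
  rw [liftCubeG_eq_liftOp, comp_liftOp_of_comm n hM c S (symbOp_divAdj_comp_pullVR n hM ν cc), mulOp_chiCube_comp_liftOp]

omit [NeZero L] in
/-- ★★ **THE FAMILY TRANSFER THEOREM AT ANY SPACING `n`** (blocks `B(x) = ⌊x∕n⌋` read at scale `k`): any small-torus operator with a cube-cut letter transplants with the SAME letter in the big torus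
distance — the fine members `n = L^r·L^k` of the two-grid rows included. [cite: Balaban1984PropagatorsII, (2.133) p.247 (shape), p.238 (T_□)] -/
theorem hasMaj_transplant_cube_family_spacing (hL : Odd L ∧ 1 < L) {s mT k : ℕ} (hs : s ≤ mT) (n : ℕ) [NeZero n] (c : Tor (MP (paramsOf d L mT k hL)))
    (X' : Module.End ℝ (Tor (fine n (MP (paramsOf d L s k hL))) × Fin (d + 1) → ℝ)) {β δ : ℝ} (hβ : 0 ≤ β)
    (hX : HasMaj (BlockNorm.ofBlocks (unitTorusGeo L k (MP (paramsOf d L s k hL))) (fun i : Tor (fine n (MP (paramsOf d L s k hL))) × Fin (d + 1) => blockOf n (MP (paramsOf d L s k hL)) i.1))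
      (BlockNorm.ofBlocks (unitTorusGeo L k (MP (paramsOf d L s k hL))) (fun i : Tor (fine n (MP (paramsOf d L s k hL))) × Fin (d + 1) => blockOf n (MP (paramsOf d L s k hL)) i.1))
      (mulOp (chiCube (MP (paramsOf d L s k hL)) n (torRed (MP_dvd_MP hL hs k) c) (L ^ s)) ∘ₗ X')
      (fun y y' => ind ((cubeBlocks (MP (paramsOf d L s k hL)) (torRed (MP_dvd_MP hL hs k) c) (L ^ s) : Finset _) : Set _) y *
        ind ((cubeBlocks (MP (paramsOf d L s k hL)) (torRed (MP_dvd_MP hL hs k) c) (L ^ s) : Finset _) : Set _) y' *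
        (β * Real.exp (-(δ * tdistT (MP (paramsOf d L s k hL)) y y'))))) :
    HasMaj (BlockNorm.ofBlocks (unitTorusGeo L k (MP (paramsOf d L mT k hL))) (fun i : Tor (fine n (MP (paramsOf d L mT k hL))) × Fin (d + 1) => blockOf n (MP (paramsOf d L mT k hL)) i.1))
      (BlockNorm.ofBlocks (unitTorusGeo L k (MP (paramsOf d L mT k hL))) (fun i : Tor (fine n (MP (paramsOf d L mT k hL))) × Fin (d + 1) => blockOf n (MP (paramsOf d L mT k hL)) i.1))
      (transplant (cubeW n c (L ^ s)) (redBond n (MP_dvd_MP hL hs k)) X')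
      (fun y y' => ind ((cubeBlocks (MP (paramsOf d L mT k hL)) c (L ^ s) : Finset _) : Set _) y *
        ind ((cubeBlocks (MP (paramsOf d L mT k hL)) c (L ^ s) : Finset _) : Set _) y' *
        (β * Real.exp (-(δ * tdistT (MP (paramsOf d L mT k hL)) y y')))) := by
  have hM := MP_dvd_MP (d := d) hL hs k
  have hLpos : 0 < L := by have := hL.2; omega
  have hS : ∀ ν : Fin (d + 1), L ^ s ≤ MP (paramsOf d L s k hL) ν := fun ν => by show L ^ s ≤ 2 * L ^ s; omega
  have hS2' : ∀ ν : Fin (d + 1), 2 * L ^ s ≤ MP (paramsOf d L s k hL) ν := fun ν => le_rfl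
  have hS2 : ∀ ν : Fin (d + 1), 2 * L ^ s ≤ MP (paramsOf d L mT k hL) ν := fun ν => by
    show 2 * L ^ s ≤ 2 * L ^ mT; exact Nat.mul_le_mul_left 2 (Nat.pow_le_pow_right hLpos hs)
  have e1 : transplant (cubeW n c (L ^ s)) (redBond n hM) X' =
      transplant (cubeW n c (L ^ s)) (redBond n hM) (mulOp (chiCube (MP (paramsOf d L s k hL)) n (torRed hM c) (L ^ s)) ∘ₗ X') :=
    (transplant_mulOp_comp_of_eq_one (χ := chiCube (MP (paramsOf d L s k hL)) n (torRed hM c) (L ^ s)) (fun b hb => chiCube_redBond_of_mem hS hb) _).symm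
  have key := hasMaj_transplant_of_blockMap (g := unitTorusGeo L k (MP (paramsOf d L mT k hL))) (g' := unitTorusGeo L k (MP (paramsOf d L s k hL)))
    (fun i : Tor (fine n (MP (paramsOf d L mT k hL))) × Fin (d + 1) => blockOf n (MP (paramsOf d L mT k hL)) i.1)
    (fun i : Tor (fine n (MP (paramsOf d L s k hL))) × Fin (d + 1) => blockOf n (MP (paramsOf d L s k hL)) i.1) (torRed hM) (cubeW n c (L ^ s)) (redBond n hM)
    ((cubeBlocks (MP (paramsOf d L mT k hL)) c (L ^ s) : Finset _) : Set _)
    (fun b _ => kingBlockOf_torRed (hM := hM) b.1) (fun b hb => Finset.mem_coe.mpr ((mem_cubeW b).mp hb)) (redBond_injOn_cubeW hS) (fun _ _ => ?_) hX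
  · refine (key.mono fun y y' => le_of_eq ?_).congr fun μ => (LinearMap.congr_fun e1 μ).symm
    show ind (g := unitTorusGeo L k (MP (paramsOf d L mT k hL))) ((cubeBlocks (MP (paramsOf d L mT k hL)) c (L ^ s) : Finset _) : Set _) y *
        ind (g := unitTorusGeo L k (MP (paramsOf d L mT k hL))) ((cubeBlocks (MP (paramsOf d L mT k hL)) c (L ^ s) : Finset _) : Set _) y' *
        (ind (g := unitTorusGeo L k (MP (paramsOf d L s k hL))) ((cubeBlocks (MP (paramsOf d L s k hL)) (torRed hM c) (L ^ s) : Finset _) : Set _) (torRed hM y) *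
          ind (g := unitTorusGeo L k (MP (paramsOf d L s k hL))) ((cubeBlocks (MP (paramsOf d L s k hL)) (torRed hM c) (L ^ s) : Finset _) : Set _) (torRed hM y') *
          (β * Real.exp (-(δ * tdistT (MP (paramsOf d L s k hL)) (torRed hM y) (torRed hM y'))))) =
      ind (g := unitTorusGeo L k (MP (paramsOf d L mT k hL))) ((cubeBlocks (MP (paramsOf d L mT k hL)) c (L ^ s) : Finset _) : Set _) y *
        ind (g := unitTorusGeo L k (MP (paramsOf d L mT k hL))) ((cubeBlocks (MP (paramsOf d L mT k hL)) c (L ^ s) : Finset _) : Set _) y' *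
        (β * Real.exp (-(δ * tdistT (MP (paramsOf d L mT k hL)) y y')))
    by_cases hy : y ∈ ((cubeBlocks (MP (paramsOf d L mT k hL)) c (L ^ s) : Finset _) : Set _)
    · by_cases hy' : y' ∈ ((cubeBlocks (MP (paramsOf d L mT k hL)) c (L ^ s) : Finset _) : Set _)
      · have iy : ind (g := unitTorusGeo L k (MP (paramsOf d L s k hL))) ((cubeBlocks (MP (paramsOf d L s k hL)) (torRed hM c) (L ^ s) : Finset _) : Set _)
            (torRed hM y) = 1 := by
          unfold ind; rw [if_pos (Finset.mem_coe.mpr (torRed_mem_cubeBlocks hS (Finset.mem_coe.mp hy)))]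
        have iy' : ind (g := unitTorusGeo L k (MP (paramsOf d L s k hL))) ((cubeBlocks (MP (paramsOf d L s k hL)) (torRed hM c) (L ^ s) : Finset _) : Set _)
            (torRed hM y') = 1 := by
          unfold ind; rw [if_pos (Finset.mem_coe.mpr (torRed_mem_cubeBlocks hS (Finset.mem_coe.mp hy')))]
        have hd : tdistT (MP (paramsOf d L s k hL)) (torRed hM y) (torRed hM y') = tdistT (MP (paramsOf d L mT k hL)) y y' :=
          tdistT_torRed_eq hS2 hS2' (Finset.mem_coe.mp hy) (Finset.mem_coe.mp hy')
        rw [iy, iy', one_mul, one_mul, hd]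
      · have i0 : ind (g := unitTorusGeo L k (MP (paramsOf d L mT k hL))) ((cubeBlocks (MP (paramsOf d L mT k hL)) c (L ^ s) : Finset _) : Set _) y' = 0 := by
          unfold ind; rw [if_neg hy']
        rw [i0]; ring
    · have i0 : ind (g := unitTorusGeo L k (MP (paramsOf d L mT k hL))) ((cubeBlocks (MP (paramsOf d L mT k hL)) c (L ^ s) : Finset _) : Set _) y = 0 := by
        unfold ind; rw [if_neg hy]
      rw [i0]; ring
  · exact mul_nonneg (mul_nonneg (ind_nonneg _ _) (ind_nonneg _ _)) (mul_nonneg hβ (Real.exp_nonneg _))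

/-- ★★ **THE FINE MEMBER's LETTER `hG′c` ON THE TORUS OF RECORD** (`χ_□ ∘ G^{↑}(□ + c)` at spacing `L^r·L^k`, blocks read through King's pairing), N-IIc's constants, uniform in the volume.
[cite: Balaban1984PropagatorsII, (2.133) p.247 (shape); Balaban1984PropagatorsI, Prop. 1.2 (1.110) p.35] -/
theorem hasMaj_chiCube_liftCubeG_fine (hL : Odd L ∧ 1 < L) {a : ℝ} (ha : 0 < a) :
    ∃ δ β : ℝ, 0 < δ ∧ 0 < β ∧ ∀ (s mT k r : ℕ) (hs : s ≤ mT) (hk : 1 ≤ k) (c : Tor (MP (paramsOf d L mT k hL))),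
      HasMaj (BlockNorm.ofBlocks (unitTorusGeo L k (MP (paramsOf d L mT k hL)))
          (fun i : Tor (fine (L ^ r * L ^ k) (MP (paramsOf d L mT k hL))) × Fin (d + 1) => blockOf (L ^ r * L ^ k) (MP (paramsOf d L mT k hL)) i.1))
        (BlockNorm.ofBlocks (unitTorusGeo L k (MP (paramsOf d L mT k hL)))
          (fun i : Tor (fine (L ^ r * L ^ k) (MP (paramsOf d L mT k hL))) × Fin (d + 1) => blockOf (L ^ r * L ^ k) (MP (paramsOf d L mT k hL)) i.1))
        (mulOp (chiCube (MP (paramsOf d L mT k hL)) (L ^ r * L ^ k) c (L ^ s)) ∘ₗ liftCubeG (L ^ r * L ^ k) (MP_dvd_MP hL hs k) c (L ^ s) a)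
        (fun y y' => ind ((cubeBlocks (MP (paramsOf d L mT k hL)) c (L ^ s) : Finset _) : Set _) y *
          ind ((cubeBlocks (MP (paramsOf d L mT k hL)) c (L ^ s) : Finset _) : Set _) y' * (β * Real.exp (-(δ * tdistT (MP (paramsOf d L mT k hL)) y y')))) := by
  obtain ⟨δ, β, hδ, hβ, H⟩ := hasMaj_chiCube_neumannCubeG_fine (d := d) hL ha
  refine ⟨δ, β, hδ, hβ, fun s mT k r hs hk c => ?_⟩
  exact (hasMaj_transplant_cube_family_spacing hL hs (L ^ r * L ^ k) c _ hβ.le (H s k r hk (torRed (MP_dvd_MP hL hs k) c))).congr fun μ =>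
    (LinearMap.congr_fun (mulOp_chiCube_comp_liftCubeG (L ^ r * L ^ k) (MP_dvd_MP hL hs k) c (L ^ s) a) μ).symm

/-- ★★ **THE (α) OUTPUT-CUT ADJOINT-DIFFERENCE ROWS ON THE TORUS OF RECORD, BOTH SPACINGS** (`χ_□ ∘ ∇*_μ ∘ G^{↑}(□ + c)`, N-IIf's constants), uniform in the volume.
[cite: Balaban1984PropagatorsII, (2.133) p.247 (shape); Balaban1984PropagatorsI, Prop. 1.2 (1.110) p.35] -/
theorem hasMaj_chiCube_divAdjOut_liftCubeG_pair (hL : Odd L ∧ 1 < L) {a : ℝ} (ha : 0 < a) :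
    ∃ δ β : ℝ, 0 < δ ∧ 0 < β ∧ ∀ (s mT k r : ℕ) (hs : s ≤ mT) (hk : 1 ≤ k) (c : Tor (MP (paramsOf d L mT k hL))) (μ : Fin (d + 1)),
      HasMaj (BlockNorm.ofBlocks (unitTorusGeo L k (MP (paramsOf d L mT k hL))) (blkFine L k (MP (paramsOf d L mT k hL))))
          (BlockNorm.ofBlocks (unitTorusGeo L k (MP (paramsOf d L mT k hL))) (blkFine L k (MP (paramsOf d L mT k hL))))
          (mulOp (chiCube (MP (paramsOf d L mT k hL)) (L ^ k) c (L ^ s)) ∘ₗ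
            symbOp (MP (paramsOf d L mT k hL)) (L ^ k) (((L ^ k : ℕ) : ℝ) • (sTinv (MP (paramsOf d L mT k hL)) (L ^ k) μ - 1)) ∘ₗ
              liftCubeG (L ^ k) (MP_dvd_MP hL hs k) c (L ^ s) a)
          (fun y y' => ind ((cubeBlocks (MP (paramsOf d L mT k hL)) c (L ^ s) : Finset _) : Set _) y *
            ind ((cubeBlocks (MP (paramsOf d L mT k hL)) c (L ^ s) : Finset _) : Set _) y' * (β * Real.exp (-(δ * tdistT (MP (paramsOf d L mT k hL)) y y')))) ∧
        HasMaj (BlockNorm.ofBlocks (unitTorusGeo L k (MP (paramsOf d L mT k hL)))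
            (fun i : Tor (fine (L ^ r * L ^ k) (MP (paramsOf d L mT k hL))) × Fin (d + 1) => blockOf (L ^ r * L ^ k) (MP (paramsOf d L mT k hL)) i.1))
          (BlockNorm.ofBlocks (unitTorusGeo L k (MP (paramsOf d L mT k hL)))
            (fun i : Tor (fine (L ^ r * L ^ k) (MP (paramsOf d L mT k hL))) × Fin (d + 1) => blockOf (L ^ r * L ^ k) (MP (paramsOf d L mT k hL)) i.1))
          (mulOp (chiCube (MP (paramsOf d L mT k hL)) (L ^ r * L ^ k) c (L ^ s)) ∘ₗ
            symbOp (MP (paramsOf d L mT k hL)) (L ^ r * L ^ k) (((L ^ r * L ^ k : ℕ) : ℝ) • (sTinv (MP (paramsOf d L mT k hL)) (L ^ r * L ^ k) μ - 1)) ∘ₗ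
              liftCubeG (L ^ r * L ^ k) (MP_dvd_MP hL hs k) c (L ^ s) a)
          (fun y y' => ind ((cubeBlocks (MP (paramsOf d L mT k hL)) c (L ^ s) : Finset _) : Set _) y *
            ind ((cubeBlocks (MP (paramsOf d L mT k hL)) c (L ^ s) : Finset _) : Set _) y' * (β * Real.exp (-(δ * tdistT (MP (paramsOf d L mT k hL)) y y')))) := by
  obtain ⟨δ, β, hδ, hβ, H⟩ := hasMaj_chiCube_divAdjOut_neumannCubeG_pair (d := d) hL ha
  refine ⟨δ, β, hδ, hβ, fun s mT k r hs hk c μ => ⟨?_, ?_⟩⟩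
  · exact (hasMaj_transplant_cube_family_spacing hL hs (L ^ k) c _ hβ.le ((H s k r hk (torRed (MP_dvd_MP hL hs k) c) μ).1)).congr fun f =>
      (LinearMap.congr_fun (mulOp_chiCube_comp_divAdj_comp_liftCubeG (L ^ k) (MP_dvd_MP hL hs k) c (L ^ s) a μ ((L ^ k : ℕ) : ℝ)) f).symm
  · exact (hasMaj_transplant_cube_family_spacing hL hs (L ^ r * L ^ k) c _ hβ.le ((H s k r hk (torRed (MP_dvd_MP hL hs k) c) μ).2)).congr fun f =>
      (LinearMap.congr_fun (mulOp_chiCube_comp_divAdj_comp_liftCubeG (L ^ r * L ^ k) (MP_dvd_MP hL hs k) c (L ^ s) a μ ((L ^ r * L ^ k : ℕ) : ℝ)) f).symm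

/-- ★★★ **THE TWO-GRID η-DEFECT OF THE (α) ADJOINT-DIFFERENCE ROWS OF THE LIFTED CUBES ON THE TORUS OF RECORD** (`𝔇(χ_□∇*′G₂^{↑}, χ_□∇*G₁^{↑})`): N-IIh's letter
`1_□1_□·m·(L^k)^{−1∕16}·e^{−δd}` (for `4 ≤ L^k`), for EVERY `s ≤ m_T`, `k`, `r`, corner `c`, direction `ν` — uniform in the volume. [cite: Balaban1984PropagatorsII, (2.133)–(2.136) p.247 (shapes); Balaban1984PropagatorsI, (1.111) p.36, (1.121)–(1.123) p.37] -/
theorem hasMaj_idef_chiCube_divAdjOut_liftCubeG (hLodd : Odd L) (hL2 : 2 ≤ L) {a : ℝ} (ha : 0 < a) :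
    ∃ δ m : ℝ, 0 < δ ∧ 0 < m ∧ ∀ (s mT k r : ℕ) (hk : 1 ≤ k) (hn4 : 4 ≤ L ^ k) (hL : Odd L ∧ 1 < L) (hs : s ≤ mT) (c : Tor (MP (paramsOf d L mT k hL))) (ν : Fin (d + 1)),
      HasMaj (BlockNorm.ofBlocks (unitTorusGeo L k (MP (paramsOf d L mT k hL))) (blkFine L k (MP (paramsOf d L mT k hL))))
        (BlockNorm.ofBlocks (unitTorusGeo L k (MP (paramsOf d L mT k hL)))
          (fun i : Tor (fine (L ^ r * L ^ k) (MP (paramsOf d L mT k hL))) × Fin (d + 1) => blockOf (L ^ r * L ^ k) (MP (paramsOf d L mT k hL)) i.1))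
        (idef (pull (kingPrV L k r (MP (paramsOf d L mT k hL)))) (pull (kingPrV L k r (MP (paramsOf d L mT k hL))))
          (mulOp (chiCube (MP (paramsOf d L mT k hL)) (L ^ r * L ^ k) c (L ^ s)) ∘ₗ
            symbOp (MP (paramsOf d L mT k hL)) (L ^ r * L ^ k) (((L ^ r * L ^ k : ℕ) : ℝ) • (sTinv (MP (paramsOf d L mT k hL)) (L ^ r * L ^ k) ν - 1)) ∘ₗ
              liftCubeG (L ^ r * L ^ k) (MP_dvd_MP hL hs k) c (L ^ s) a)
          (mulOp (chiCube (MP (paramsOf d L mT k hL)) (L ^ k) c (L ^ s)) ∘ₗ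
            symbOp (MP (paramsOf d L mT k hL)) (L ^ k) (((L ^ k : ℕ) : ℝ) • (sTinv (MP (paramsOf d L mT k hL)) (L ^ k) ν - 1)) ∘ₗ
              liftCubeG (L ^ k) (MP_dvd_MP hL hs k) c (L ^ s) a))
        (fun y y' => ind ((cubeBlocks (MP (paramsOf d L mT k hL)) c (L ^ s) : Finset _) : Set _) y *
          ind ((cubeBlocks (MP (paramsOf d L mT k hL)) c (L ^ s) : Finset _) : Set _) y' *
          (m * ((L ^ k : ℕ) : ℝ) ^ (-(1 / 16 : ℝ)) * Real.exp (-(δ * tdistT (MP (paramsOf d L mT k hL)) y y')))) := by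
  obtain ⟨δ, m, hδ, hm, H⟩ := hasMaj_idef_chiCube_divAdjOut_neumannCubeG (d := d) hLodd hL2 ha
  refine ⟨δ, m, hδ, hm, fun s mT k r hk hn4 hL hs c ν => ?_⟩
  have hρ : 0 ≤ m * ((L ^ k : ℕ) : ℝ) ^ (-(1 / 16 : ℝ)) := mul_nonneg hm.le (Real.rpow_nonneg (Nat.cast_nonneg _) _)
  have h := hasMaj_idef_transplant_cube_family (d := d) hL (r := r) hs c _ _ hρ (H s k r hk hn4 hL (torRed (MP_dvd_MP hL hs k) c) ν)
  have e₂ := mulOp_chiCube_comp_divAdj_comp_liftCubeG (L ^ r * L ^ k) (MP_dvd_MP hL hs k) c (L ^ s) a ν ((L ^ r * L ^ k : ℕ) : ℝ)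
  have e₁ := mulOp_chiCube_comp_divAdj_comp_liftCubeG (L ^ k) (MP_dvd_MP hL hs k) c (L ^ s) a ν ((L ^ k : ℕ) : ℝ)
  have E := congrArg₂ (idef (pull (kingPrV L k r (MP (paramsOf d L mT k hL)))) (pull (kingPrV L k r (MP (paramsOf d L mT k hL))))) e₂ e₁
  refine (h.mono fun y y' => le_of_eq ?_).congr fun μ => (LinearMap.congr_fun E μ).symm
  ring

end AnySpacing

end Summit.QuantumFields.YangMills.BalabanUVNodes.N15.TwoGrid

end
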